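import Mathlib.Algebra.Order.Monoid.Prod
import Mathlib.Algebra.Order.Pi
import Mathlib.RingTheory.MvPolynomial.WeightedHomogeneous
import Literature.Computability.AlgebraicComplexity.LRPencilOfMatrix
import Literature.Computability.AlgebraicComplexity.SymbolicMatrixDecomposition

/-!
# Crux `RigidMinimalReps.MinimalRepTorusSymmetric` (stmt-ValiantsHypothesis-5112), line `birth` —
# stub `stub_initialForm`: the initial form of a representation along a sub-potential

Let `A` be an `s × s` matrix of affine linear forms in the variables `x_{kl}` (`k, l : Fin n`) with
`det A = per_n`, and let `α, β : Fin s → M`, `M = (Fin n → ℤ) × (Fin n → ℤ)` (the character lattice of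
the two-sided torus, componentwise order) be a SUB-POTENTIAL: every monomial present in the entry
`A i j` has torus weight `≥ α i + β j` (a constant has weight `0`, the variable `x_{kl}` has weight
`(e_k, e_l)`), and `Σ α + Σ β = 𝟙 = (1, 1)`, the weight of every monomial of `per_n`.  Then the
INITIAL FORM `A⁰`, `A⁰ i j :=` the weight-`(α i + β j)` component of `A i j`, is again an affine
determinantal representation of `per_n`, its supports sit inside those of `A`, and it is TIGHT (every
monomial of `A⁰ i j` has weight exactly `α i + β j`).

Proof.  Grade `ℂ[x]` by `w (k,l) = (e_k, e_l)`.  If all monomials of `p` have weight `≥ μ` and all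
monomials of `q` have weight `≥ ν`, then all monomials of `p q` have weight `≥ μ + ν` and the
weight-`(μ + ν)` component of `p q` is the product of the weight-`μ` component of `p` and the
weight-`ν` component of `q` (no other splitting `μ' + ν' = μ + ν` with `μ' ≥ μ`, `ν' ≥ ν` exists in an
ordered cancellative monoid); iterate over finite products.  Expanding `det A = Σ_π ± Π_i A (π i) i`
and using `Σ_i (α (π i) + β i) = Σ α + Σ β = 𝟙` for every permutation `π`, the weight-`𝟙` component of
`det A` is `det A⁰`; and `per_n = Σ_π Π_i x_{π i, i}` is weighted-homogeneous of weight
`(Σ_i e_{π i}, Σ_i e_i) = 𝟙`, so `det A⁰ = (per_n)_𝟙 = per_n`.  (This is the Białynicki-Birula sink of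
the gauge class of `A` along a dominant one-parameter subgroup of the torus.)

Helper file for the crux (`--supports`); it closes nothing by itself.
-/

-- `Summit.ValiantsHypothesis.ValiantsHypothesis.…` is the tree's mandated single-conjunct layout
-- (Sub = Summit), so the duplicated namespace component is intended.
set_option linter.dupNamespace false

noncomputable section

namespace Summit.ValiantsHypothesis.ValiantsHypothesis.Theorems.RigidMinimalRepsMinimalRepTorusSymmetric

open Matrix MvPolynomial Finset
open Literature.Computability.AlgebraicComplexity LRPencil

namespace InitialForm

section General

variable {R : Type*} [CommRing R] {σ : Type*} {M : Type*}

/-- **Lower bounds multiply.** If every monomial of `p` has weight `≥ μ` and every monomial of `q`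
has weight `≥ ν`, then every monomial of `p q` has weight `≥ μ + ν`. [folklore] -/
theorem le_weight_mul [DecidableEq σ] [AddCommMonoid M] [Preorder M] [IsOrderedAddMonoid M]
    (w : σ → M) {p q : MvPolynomial σ R} {μ ν : M}
    (hp : ∀ d, coeff d p ≠ 0 → μ ≤ Finsupp.weight w d)
    (hq : ∀ d, coeff d q ≠ 0 → ν ≤ Finsupp.weight w d) :
    ∀ d, coeff d (p * q) ≠ 0 → μ + ν ≤ Finsupp.weight w d := by
  intro d hd
  rw [coeff_mul] at hd
  obtain ⟨x, hx, hx0⟩ := Finset.exists_ne_zero_of_sum_ne_zero hd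
  rw [Finset.mem_antidiagonal] at hx
  rw [← hx, map_add]
  exact add_le_add (hp _ (left_ne_zero_of_mul hx0)) (hq _ (right_ne_zero_of_mul hx0))

/-- **Bottom components multiply.** If every monomial of `p` has weight `≥ μ` and every monomial of
`q` has weight `≥ ν` (in an ordered abelian group of weights), then the weight-`(μ + ν)` component of
`p q` is the product of the weight-`μ` component of `p` and the weight-`ν` component of `q`: the
only splitting `μ' + ν' = μ + ν` with `μ ≤ μ'`, `ν ≤ ν'` is `(μ, ν)`. [folklore] -/
theorem weightedHomogeneousComponent_mul_of_le [DecidableEq σ] [AddCommGroup M] [PartialOrder M]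
    [IsOrderedAddMonoid M] [DecidableEq M] (w : σ → M) {p q : MvPolynomial σ R} {μ ν : M}
    (hp : ∀ d, coeff d p ≠ 0 → μ ≤ Finsupp.weight w d)
    (hq : ∀ d, coeff d q ≠ 0 → ν ≤ Finsupp.weight w d) :
    weightedHomogeneousComponent w (μ + ν) (p * q) =
      weightedHomogeneousComponent w μ p * weightedHomogeneousComponent w ν q := by
  rw [weightedHomogeneousComponent_mul_eq_sum w p q (μ + ν) {(μ, ν)} (by simp) ?_,
    Finset.sum_singleton]
  intro s t hs ht hst
  rw [Finset.mem_singleton, Prod.mk.injEq]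
  have h1 : Finsupp.weight w s + ν ≤ μ + ν :=
    (add_le_add le_rfl (hq t ht)).trans hst.le
  have hs' : Finsupp.weight w s = μ := le_antisymm (le_of_add_le_add_right h1) (hp s hs)
  refine ⟨hs', ?_⟩
  rw [hs'] at hst
  exact add_left_cancel hst

/-- **Bottom components of a finite product.** If every monomial of `p i` has weight `≥ μ i`
(`i ∈ s`), then every monomial of `Π_{i ∈ s} p i` has weight `≥ Σ_{i ∈ s} μ i`, and the
weight-`(Σ μ i)` component of the product is the product of the weight-`(μ i)` components. [folklore] -/
theorem weightedHomogeneousComponent_prod_of_le [DecidableEq σ] [AddCommGroup M] [PartialOrder M]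
    [IsOrderedAddMonoid M] [DecidableEq M] (w : σ → M) {ι : Type*} (s : Finset ι)
    (p : ι → MvPolynomial σ R) (μ : ι → M) :
    (∀ i ∈ s, ∀ d, coeff d (p i) ≠ 0 → μ i ≤ Finsupp.weight w d) →
    (∀ d, coeff d (∏ i ∈ s, p i) ≠ 0 → ∑ i ∈ s, μ i ≤ Finsupp.weight w d) ∧
      weightedHomogeneousComponent w (∑ i ∈ s, μ i) (∏ i ∈ s, p i) =
        ∏ i ∈ s, weightedHomogeneousComponent w (μ i) (p i) := by
  classical
  refine Finset.induction_on s (fun _ => ⟨fun d hd => ?_, ?_⟩) ?_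
  · rw [Finset.prod_empty, coeff_one] at hd
    have hd0 : d = 0 := by
      by_contra h
      exact hd (if_neg (Ne.symm h))
    rw [hd0, Finset.sum_empty, map_zero]
  · rw [Finset.prod_empty, Finset.sum_empty, Finset.prod_empty]
    exact (isWeightedHomogeneous_one R w).weightedHomogeneousComponent_same
  · intro a s ha ih hp
    have hpa := hp a (Finset.mem_insert_self a s)
    obtain ⟨ih1, ih2⟩ := ih fun i hi => hp i (Finset.mem_insert_of_mem hi)
    rw [Finset.prod_insert ha, Finset.sum_insert ha, Finset.prod_insert ha]
    exact ⟨le_weight_mul w hpa ih1, by rw [weightedHomogeneousComponent_mul_of_le w hpa ih1, ih2]⟩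

/-- **Affine entries.** A polynomial of total degree `≤ 1` whose constant term is nonzero only if
`m ≤ 0` and whose `x_v`-coefficient is nonzero only if `m ≤ w v` has all its monomials of weight
`≥ m` (its monomials are `1` and the `x_v`). [folklore] -/
theorem le_weight_of_totalDegree_le_one [AddCommMonoid M] [LE M] (w : σ → M)
    {p : MvPolynomial σ R} (hp : p.totalDegree ≤ 1) {m : M}
    (h0 : coeff 0 p ≠ 0 → m ≤ 0) (h1 : ∀ v, coeff (Finsupp.single v 1) p ≠ 0 → m ≤ w v) :
    ∀ d, coeff d p ≠ 0 → m ≤ Finsupp.weight w d := by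
  intro d hd
  by_cases hd0 : d = 0
  · rw [hd0] at hd ⊢
    rw [map_zero]
    exact h0 hd
  · obtain ⟨v, rfl⟩ := exists_single_of_sum_le_one hd0
      ((le_totalDegree (mem_support_iff.mpr hd)).trans hp)
    rw [Finsupp.weight_single, one_smul]
    exact h1 v hd

/-- The support of a weighted-homogeneous component is contained in the support. [folklore] -/
theorem support_weightedHomogeneousComponent_subset [AddCommMonoid M] (w : σ → M) (m : M)
    (p : MvPolynomial σ R) : (weightedHomogeneousComponent w m p).support ⊆ p.support := by
  classical
  intro d hd
  rw [mem_support_iff, coeff_weightedHomogeneousComponent] at hd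
  rw [mem_support_iff]
  split_ifs at hd with h
  · exact hd
  · exact absurd rfl hd

/-- **The weight-`ω` component of a determinant with a sub-potential.** If every monomial of
`A i j` has weight `≥ a i + b j`, then the weight-`(Σ a + Σ b)` component of `det A` is the
determinant of the matrix of weight-`(a i + b j)` components (expand over permutations;
`Σ_i (a (π i) + b i) = Σ a + Σ b`). [folklore] -/
theorem weightedHomogeneousComponent_det_of_le [DecidableEq σ] [AddCommGroup M] [PartialOrder M]
    [IsOrderedAddMonoid M] [DecidableEq M] (w : σ → M) {ι : Type*} [Fintype ι] [DecidableEq ι]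
    (A : Matrix ι ι (MvPolynomial σ R)) (a b : ι → M)
    (hA : ∀ i j d, coeff d (A i j) ≠ 0 → a i + b j ≤ Finsupp.weight w d) :
    weightedHomogeneousComponent w (∑ i, a i + ∑ j, b j) A.det =
      (Matrix.of fun i j => weightedHomogeneousComponent w (a i + b j) (A i j)).det := by
  rw [Matrix.det_apply', Matrix.det_apply', map_sum]
  refine Finset.sum_congr rfl fun π _ => ?_
  rw [← map_intCast (C : R →+* MvPolynomial σ R), weightedHomogeneousComponent_C_mul]
  congr 1
  have hsum : ∑ i, (a (π i) + b i) = ∑ i, a i + ∑ j, b j := by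
    rw [Finset.sum_add_distrib, Equiv.sum_comp π a]
  rw [← hsum, (weightedHomogeneousComponent_prod_of_le w Finset.univ (fun i => A (π i) i)
    (fun i => a (π i) + b i) fun i _ => hA (π i) i).2]
  simp only [Matrix.of_apply]

end General

/-! ### The two-sided torus grading on `ℂ[x_{kl}]` and the permanent -/

/-- **The permanent is bihomogeneous of weight `𝟙`.** For the two-sided torus grading
`w (k, l) = (e_k, e_l)` on the `n²` variables, `per_n = Σ_π Π_i x_{π i, i}` is weighted-homogeneous of
weight `(Σ_i e_{π i}, Σ_i e_i) = (1, 1) = 1`. [folklore] -/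
theorem perPoly_isWeightedHomogeneous (n : ℕ)
    (w : Fin n × Fin n → (Fin n → ℤ) × (Fin n → ℤ))
    (hw : ∀ v, w v = ((Pi.single v.1 1 : Fin n → ℤ), (Pi.single v.2 1 : Fin n → ℤ))) :
    IsWeightedHomogeneous w (perPoly (Fin n) ℂ) 1 := by
  unfold perPoly Matrix.permanent
  refine IsWeightedHomogeneous.sum _ _ _ fun π _ => ?_
  have h := IsWeightedHomogeneous.prod Finset.univ
    (fun i : Fin n => Matrix.mvPolynomialX (Fin n) (Fin n) ℂ (π i) i) (fun i => w (π i, i))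
    fun i _ => by simpa [Matrix.mvPolynomialX] using isWeightedHomogeneous_X ℂ w (π i, i)
  have e1 : ∑ i, (Pi.single (π i) (1 : ℤ) : Fin n → ℤ) = ∑ i, Pi.single i 1 :=
    Fintype.sum_equiv π _ _ fun _ => rfl
  have h1 : ∑ i, w (π i, i) = 1 := by
    simp only [hw]
    rw [← prod_mk_sum, e1, Finset.univ_sum_single fun _ : Fin n => (1 : ℤ)]
    rfl
  rw [h1] at h
  exact h

end InitialForm

/-- Registered stub **`stub_initialForm`** of the line `birth` on the crux
`RigidMinimalReps.MinimalRepTorusSymmetric`: **the initial form of an affine determinantal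
representation of `per_n` along a sub-potential is again an affine determinantal representation of
`per_n`, of the same size, with supports inside the original ones, and TIGHT.**  Given `A` affine with
`det A = per_n` and potentials `α, β : Fin s → (Fin n → ℤ) × (Fin n → ℤ)` with
`Λ_{ij} ≠ 0 ⇒ α i + β j ≤ 0`, `(A_{kl})_{ij} ≠ 0 ⇒ α i + β j ≤ (e_k, e_l)` and `Σ α + Σ β = 𝟙`, the
matrix `A⁰ i j :=` (weight-`(α i + β j)` component of `A i j`) for the grading `x_{kl} ↦ (e_k, e_l)`
works: `det A⁰` is the weight-`𝟙` component of `det A = per_n`, which is `per_n` itself.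
[cite: Bialynickibirula1973, Thm. 4.1] [cite: LandsbergRessayre2017, §3] -/
theorem stub_initialForm :
    ∀ (n s : ℕ) (A : Matrix (Fin s) (Fin s) (MvPolynomial (Fin n × Fin n) ℂ))
    (α β : Fin s → (Fin n → ℤ) × (Fin n → ℤ)),
    IsAffineDetRepr (perPoly (Fin n) ℂ) A →
    (∀ i j, constPart A i j ≠ 0 → α i + β j ≤ 0) →
    (∀ i j (v : Fin n × Fin n), coeffMat A v i j ≠ 0 →
      α i + β j ≤ ((Pi.single v.1 1 : Fin n → ℤ), (Pi.single v.2 1 : Fin n → ℤ))) →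
    ∑ i, α i + ∑ j, β j = 1 →
    ∃ A' : Matrix (Fin s) (Fin s) (MvPolynomial (Fin n × Fin n) ℂ),
      IsAffineDetRepr (perPoly (Fin n) ℂ) A' ∧
      (∀ i j, (A' i j).support ⊆ (A i j).support) ∧
      (∀ i j, constPart A' i j ≠ 0 → α i + β j = 0) ∧
      (∀ i j (v : Fin n × Fin n), coeffMat A' v i j ≠ 0 →
        α i + β j = ((Pi.single v.1 1 : Fin n → ℤ), (Pi.single v.2 1 : Fin n → ℤ))) := by
  intro n s A α β hA h0 h1 hsum
  -- the two-sided torus grading, kept opaque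
  obtain ⟨w, hw⟩ : ∃ w : Fin n × Fin n → (Fin n → ℤ) × (Fin n → ℤ),
      ∀ v, w v = ((Pi.single v.1 1 : Fin n → ℤ), (Pi.single v.2 1 : Fin n → ℤ)) :=
    ⟨_, fun _ => rfl⟩
  -- every monomial of the affine entry `A i j` has weight `≥ α i + β j`
  have hle : ∀ i j d, coeff d (A i j) ≠ 0 → α i + β j ≤ Finsupp.weight w d := fun i j =>
    InitialForm.le_weight_of_totalDegree_le_one w (hA.1 i j)
      (fun h => h0 i j (by rwa [constPart_apply, constantCoeff_eq]))
      fun v h => by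
        rw [hw]
        exact h1 i j v (by rwa [coeffMat_apply])
  refine ⟨Matrix.of fun i j => weightedHomogeneousComponent w (α i + β j) (A i j),
    ⟨fun i j => ?_, ?_⟩, fun i j => ?_, fun i j hij => ?_, fun i j v hv => ?_⟩
  · -- affine entries: the support only shrinks
    rw [Matrix.of_apply]
    exact (totalDegree_le_of_support_subset
      (InitialForm.support_weightedHomogeneousComponent_subset w _ _)).trans (hA.1 i j)
  · -- `det A⁰ = (det A)_𝟙 = (per_n)_𝟙 = per_n`
    rw [← InitialForm.weightedHomogeneousComponent_det_of_le w A α β hle, hsum, hA.2]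
    exact (InitialForm.perPoly_isWeightedHomogeneous n w hw).weightedHomogeneousComponent_same
  · rw [Matrix.of_apply]
    exact InitialForm.support_weightedHomogeneousComponent_subset w _ _
  · -- tightness of the constants: weight `0 = α i + β j`
    rw [constPart_apply, Matrix.of_apply, constantCoeff_eq] at hij
    have h := weightedHomogeneousComponent_isWeightedHomogeneous (α i + β j) (A i j) hij
    rw [map_zero] at h
    exact h.symm
  · -- tightness of the variables: weight `(e_k, e_l) = α i + β j`
    rw [coeffMat_apply, Matrix.of_apply] at hv
    have h := weightedHomogeneousComponent_isWeightedHomogeneous (α i + β j) (A i j) hv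
    rw [Finsupp.weight_single, one_smul, hw] at h
    exact h.symm

end Summit.ValiantsHypothesis.ValiantsHypothesis.Theorems.RigidMinimalRepsMinimalRepTorusSymmetric
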